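import Summits.AtomisticToContinuum.HydrodynamicLimit.Theorems.StiffCollisionalRelaxationAprioriBoundsFibreDefsR4
import Summits.AtomisticToContinuum.HydrodynamicLimit.Theorems.StiffCollisionalRelaxationAprioriBoundsEquilibriumStatics
import Summits.AtomisticToContinuum.HydrodynamicLimit.Theorems.JParityClosureOddContactSymmetryGibbsInvariance
import HarnessLib

/-!
# Unit tests of the stub `occupationVariance` (line `meso-chebyshev-window`, crux `AprioriBounds`,
stmt-AtomisticToContinuum-14827): the degenerate levels and the equilibrium rung, for EVERY flow

Supporting file (`--supports stmt-AtomisticToContinuum-14827`) of the lead prover of the line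
`Cruxes/AprioriBounds/Lines/meso_chebyshev_window.lean`, stub 6 `stub_occupationVariance` (OPEN IN KIND; its
conditional Efron–Stein dock is `…MesoOccupationVarianceDock.lean`).  The stub asks, under the crux prefix and for
every fixed level `K`, that the variance under the local Gibbs law `P_N` of the time-integrated one-particle tail
occupation `occ_K(z) = ∫₀ᵗ frac_K(Φ_s z) ds` tend to `0`.  Two TRUE instances are kernel-checked here:

* §0 DEGENERATE LEVELS `K ≤ 0` (`variance_occ_of_nonpos`): `frac_K ≡ 1` (`frac_eq_one_of_nonpos`), so `occ_K` is
  the constant `|[0,t]|` at EVERY phase point and its variance under any probability law is `0`.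
* §1–§3 THE EQUILIBRIUM RUNG (`variance_occ_le_const`, `occupationVariance_homogeneous`): at CONSTANT profiles
  `(a, θ₀, u₀)`, for `σ ≤ 1/2`, EVERY hard-sphere flow, every `t ≥ 0` and every `K`,
  `Var_{P_N}(occ_K) ≤ t² / (4(N+1))`, hence the stub's conclusion for every flow family (its crux prefix is then
  idle: `σ₀ := 1/2`, `η₁ := 1`).  Proof: (§1, statics) under the constant-profile law positions and velocities are
  independent and the velocities i.i.d. Maxwellian (`localGibbsMeasure_rung0_eq_map`), and `frac_K` is the average
  of the `N + 1` indicators `𝟙{K ≤ |vᵢ|²}`, so `Var frac_K = Var(𝟙)/ (N+1) ≤ 1/(4(N+1))` (`variance_sum_pi`,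
  Popoviciu `variance_le_sq_of_bounded`); (§2) Cauchy–Schwarz in time on each good orbit,
  `(occ_K − t·p)² ≤ t ∫₀ᵗ (frac_K(Φ_s z) − p)² ds`, `p = E frac_K`; (§3) the law is carried by the good set and
  invariant under every `Φ_s` (`measurePreserving_flow_localGibbsLaw_const`), so Tonelli
  (`AdiabatCeiling.lintegral_lintegral_comp_flow_eq`) gives `E(occ_K − t·p)² ≤ t · t · Var frac_K`, and
  `Var occ_K ≤ E(occ_K − t·p)²`.

No new definitions, no named facts; axioms `propext`, `Classical.choice`, `Quot.sound`.
-/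

noncomputable section

open MeasureTheory ProbabilityTheory Filter Set Topology
open scoped ENNReal

namespace Summit.AtomisticToContinuum.HydrodynamicLimit.Theorems.MesoChebyshevWindow

open Literature.MathematicalPhysics.KineticTheory Literature.Analysis.FluidPDE
open Summit.AtomisticToContinuum.HydrodynamicLimit.Theorems.AprioriBoundsNegative (PartOneAt PartTwoAt)
open Summit.AtomisticToContinuum.HydrodynamicLimit.Theorems.VisitLedgerUpscattering (Cfg Flow Flows NiceProfiles)
open Summit.AtomisticToContinuum.HydrodynamicLimit.Theorems.FibreDeficitTransfer

/-! ## §0 The degenerate levels `K ≤ 0` -/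

/-- For `K ≤ 0` the time-integrated occupation is the constant `|[0, t]|` at EVERY phase point (`frac_K ≡ 1`). -/
theorem occ_eq_of_nonpos {σ : ℝ} {N : ℕ} (Φ : HardSphereFlow (Torus.geometry (Fin 3)) (hsDiameter σ N) (N + 1))
    {K : ℝ} (hK : K ≤ 0) (t : ℝ) (z : Cfg N) :
    (∫⁻ s in Icc 0 t, ENNReal.ofReal (frac K (Φ.flow s z))).toReal = (volume (Icc (0 : ℝ) t)).toReal := by
  simp_rw [frac_eq_one_of_nonpos hK, ENNReal.ofReal_one, lintegral_one, Measure.restrict_apply_univ]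

/-- **Degenerate levels.**  For `K ≤ 0` the variance of `occ_K` vanishes identically under every probability law
on phase space (every flow, every `t`, every `N`): the warm-up instance of `stub_occupationVariance`. -/
theorem variance_occ_of_nonpos {σ : ℝ} {N : ℕ}
    (Φ : HardSphereFlow (Torus.geometry (Fin 3)) (hsDiameter σ N) (N + 1)) {K : ℝ} (hK : K ≤ 0) (t : ℝ)
    (P : Measure (Cfg N)) [IsProbabilityMeasure P] :
    variance (fun z => (∫⁻ s in Icc 0 t, ENNReal.ofReal (frac K (Φ.flow s z))).toReal) P = 0 := by
  have h : (fun z => (∫⁻ s in Icc 0 t, ENNReal.ofReal (frac K (Φ.flow s z))).toReal) =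
      fun _ => (volume (Icc (0 : ℝ) t)).toReal := funext fun z => occ_eq_of_nonpos Φ hK t z
  rw [h, variance_eq_integral aemeasurable_const]
  simp [integral_const]

/-- The stub's conclusion at the degenerate levels: for `K ≤ 0`, `σ ≤ 1/2` (probability laws) and nice profiles,
`Var_{P_N}(occ_K) → 0` for every flow family and every `t` (each term is `0`). -/
theorem occupationVariance_of_nonpos {σ : ℝ} (hσ2 : σ ≤ 1 / 2) {a₀ θ₀ : T3 → ℝ} {u₀ : T3 → V3}
    (hprof : NiceProfiles a₀ θ₀ u₀) (Φ : (N : ℕ) → HardSphereFlow (Torus.geometry (Fin 3)) (hsDiameter σ N) (N + 1))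
    (t : ℝ) {K : ℝ} (hK : K ≤ 0) :
    Tendsto (fun N : ℕ => variance
      (fun z => (∫⁻ s in Icc 0 t, ENNReal.ofReal (frac K ((Φ N).flow s z))).toReal)
      (localGibbsLaw σ a₀ u₀ θ₀ N (Φ N))) atTop (𝓝 0) := by
  obtain ⟨ha, hθ, hu, ha0, hθ0⟩ := hprof
  have h : ∀ N : ℕ, variance (fun z => (∫⁻ s in Icc 0 t, ENNReal.ofReal (frac K ((Φ N).flow s z))).toReal)
      (localGibbsLaw σ a₀ u₀ θ₀ N (Φ N)) = 0 := fun N => by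
    haveI := isProbabilityMeasure_localGibbsLaw ha hθ hu ha0 hθ0 hσ2 N (Φ N)
    exact variance_occ_of_nonpos (Φ N) hK t _
  simp only [h]
  exact tendsto_const_nhds

/-! ## §1 Statics: `Var_{P_N}(frac_K) ≤ 1/(4(N+1))` at constant profiles -/

/-- **Static variance of the tail fraction at constant profiles.**  Under `localGibbsLaw σ a u₀ θ₀ N Φ` with
CONSTANT profiles (`σ ≤ 1/2`, `a, θ₀ > 0`; any flow label) the velocities are i.i.d. `N(u₀, θ₀)` and independent
of the positions (`localGibbsMeasure_rung0_eq_map`), and `frac_K = (N+1)⁻¹ ∑ᵢ 𝟙{K ≤ |vᵢ|²}`, so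
`Var frac_K = (N+1)⁻² ∑ᵢ Var 𝟙{K ≤ |vᵢ|²} ≤ 1/(4(N+1))` (Bienaymé `variance_sum_pi`, Popoviciu). -/
theorem variance_frac_le_const {σ a θ₀ : ℝ} (u₀ : V3) (hσ2 : σ ≤ 1 / 2) (ha : 0 < a) (hθ : 0 < θ₀) (N : ℕ)
    (Φ : HardSphereFlow (Torus.geometry (Fin 3)) (hsDiameter σ N) (N + 1)) (K : ℝ) :
    variance (frac (N := N) K) (localGibbsLaw σ (fun _ => a) (fun _ => u₀) (fun _ => θ₀) N Φ) ≤
      1 / (4 * ((N + 1 : ℕ) : ℝ)) := by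
  set P : Measure (Cfg N) := localGibbsLaw σ (fun _ => a) (fun _ => u₀) (fun _ => θ₀) N Φ with hP
  set γ : Measure V3 := gaussMeasure u₀ θ₀ with hγ
  set ind : V3 → ℝ := fun v => if K ≤ ‖v‖ ^ 2 then 1 else 0 with hind
  have hindm : Measurable ind :=
    Measurable.ite (measurableSet_le measurable_const (measurable_norm.pow_const 2)) measurable_const
      measurable_const
  have hind01 : ∀ v, ind v ∈ Icc (0 : ℝ) 1 := fun v => by
    simp only [hind]
    split_ifs <;> norm_num
  set h : (Fin (N + 1) → V3) → ℝ := fun v => ((N + 1 : ℕ) : ℝ)⁻¹ * ∑ i, ind (v i) with hh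
  have hhm : Measurable h :=
    measurable_const.mul (Finset.measurable_sum _ fun i _ => hindm.comp (measurable_pi_apply i))
  set vel : Cfg N → (Fin (N + 1) → V3) := fun z i => (z i).2 with hvel
  have hvelm : Measurable vel := measurable_pi_lambda _ fun i => (measurable_pi_apply i).snd
  -- `frac_K` is a velocity observable
  have hfrac : frac (N := N) K = fun z => h (vel z) := funext fun z => frac_eq_avg K z
  -- the velocity marginal is the Maxwellian product
  have hmp : MeasurePreserving vel P (Measure.pi fun _ : Fin (N + 1) => γ) := by
    refine ⟨hvelm, ?_⟩
    haveI : IsProbabilityMeasure (posGibbsMeasure (fun _ : T3 => a) (hsDiameter σ N) (N + 1)) :=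
      isProbabilityMeasure_posGibbsMeasure continuous_const (fun _ => ha) hσ2 N
    rw [hP, localGibbsLaw_eq, localGibbsMeasure_rung0_eq_map σ ha.le hθ u₀ N,
      Measure.map_map hvelm measurable_zipConfig]
    have hcomp : vel ∘ zipConfig = (Prod.snd : (Fin (N + 1) → T3) × (Fin (N + 1) → V3) → Fin (N + 1) → V3) := by
      funext p
      rfl
    rw [hcomp, Measure.map_snd_prod, measure_univ, one_smul]
  rw [hfrac, hmp.variance_fun_comp hhm.aemeasurable]
  -- Bienaymé on the product
  have hsum : h = fun v => ((N + 1 : ℕ) : ℝ)⁻¹ * (∑ i, fun w : Fin (N + 1) → V3 => ind (w i)) v := by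
    funext v
    simp only [hh, Finset.sum_apply]
  have hmem : ∀ _i : Fin (N + 1), MemLp ind 2 γ := fun _ =>
    memLp_of_bounded (Eventually.of_forall hind01) hindm.aestronglyMeasurable 2
  rw [hsum, variance_const_mul, variance_sum_pi (X := fun _ => ind) hmem]
  have hvar : Var[ind; γ] ≤ 1 / 4 :=
    (variance_le_sq_of_bounded (Eventually.of_forall hind01) hindm.aemeasurable).trans (by norm_num)
  calc ((N + 1 : ℕ) : ℝ)⁻¹ ^ 2 * ∑ _i : Fin (N + 1), Var[ind; γ]
      ≤ ((N + 1 : ℕ) : ℝ)⁻¹ ^ 2 * ∑ _i : Fin (N + 1), (1 / 4 : ℝ) := by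
        gcongr with i
    _ = 1 / (4 * ((N + 1 : ℕ) : ℝ)) := by
        rw [Finset.sum_const, Finset.card_univ, Fintype.card_fin, nsmul_eq_mul]
        field_simp

/-! ## §2 Cauchy–Schwarz in time -/

/-- Cauchy–Schwarz for a finite measure: `(∫ g)² ≤ ν(univ) · ∫ g²` (the quadratic `τ ↦ ∫ (τ + g)² ≥ 0` has
non-positive discriminant). -/
theorem sq_integral_le_measureReal_mul_integral_sq {ν : Measure ℝ} [IsFiniteMeasure ν] {g : ℝ → ℝ}
    (hg : Integrable g ν) (hg2 : Integrable (fun s => g s ^ 2) ν) :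
    (∫ s, g s ∂ν) ^ 2 ≤ ν.real univ * ∫ s, g s ^ 2 ∂ν := by
  have hq : ∀ τ : ℝ, 0 ≤ ν.real univ * (τ * τ) + (2 * ∫ s, g s ∂ν) * τ + ∫ s, g s ^ 2 ∂ν := by
    intro τ
    have h1 : ∫ s, (τ + g s) ^ 2 ∂ν = ν.real univ * (τ * τ) + (2 * ∫ s, g s ∂ν) * τ + ∫ s, g s ^ 2 ∂ν := by
      have h2 : (fun s => (τ + g s) ^ 2) = fun s => (τ * τ + 2 * τ * g s) + g s ^ 2 := by
        funext s
        ring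
      have i1 : Integrable (fun s => τ * τ + 2 * τ * g s) ν := (integrable_const (τ * τ)).add (hg.const_mul (2 * τ))
      have i2 : Integrable (fun _ : ℝ => τ * τ) ν := integrable_const _
      have i3 : Integrable (fun s => 2 * τ * g s) ν := hg.const_mul (2 * τ)
      rw [h2, integral_add i1 hg2, integral_add i2 i3, integral_const, integral_const_mul, smul_eq_mul]
      ring
    rw [← h1]
    exact integral_nonneg fun s => sq_nonneg _
  have hd := discrim_le_zero hq
  rw [discrim] at hd
  have hν : 0 ≤ ν.real univ := measureReal_nonneg
  nlinarith [hd, hν]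

/-! ## §3 The equilibrium rung of the stub, for every flow -/

/-- **`Var_{P_N}(occ_K) ≤ t²/(4(N+1))` AT CONSTANT PROFILES, FOR EVERY FLOW.**  For `σ ≤ 1/2`, `a, θ₀ > 0`, any
`u₀`, every `N`, every hard-sphere flow `Φ` of `N + 1` spheres, every `t ≥ 0` and every level `K`, the
time-integrated tail occupation `occ_K(z) = ∫₀ᵗ frac_K(Φ_s z) ds` has variance at most `t²/(4(N+1))` under
`localGibbsLaw σ a u₀ θ₀ N Φ`.  Proof: §1 (static variance `≤ 1/(4(N+1))`), §2 (Cauchy–Schwarz in time on good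
orbits), flow invariance (`measurePreserving_flow_localGibbsLaw_const`) and Tonelli
(`AdiabatCeiling.lintegral_lintegral_comp_flow_eq`); finally `Var X ≤ E(X − c)²` with `c = t · E frac_K`. -/
theorem variance_occ_le_const {σ a θ₀ : ℝ} (u₀ : V3) (hσ2 : σ ≤ 1 / 2) (ha : 0 < a) (hθ : 0 < θ₀) (N : ℕ)
    (Φ : HardSphereFlow (Torus.geometry (Fin 3)) (hsDiameter σ N) (N + 1)) {t : ℝ} (ht : 0 ≤ t) (K : ℝ) :
    variance (fun z => (∫⁻ s in Icc 0 t, ENNReal.ofReal (frac K (Φ.flow s z))).toReal)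
        (localGibbsLaw σ (fun _ => a) (fun _ => u₀) (fun _ => θ₀) N Φ) ≤ t ^ 2 / (4 * ((N + 1 : ℕ) : ℝ)) := by
  set P : Measure (Cfg N) := localGibbsLaw σ (fun _ => a) (fun _ => u₀) (fun _ => θ₀) N Φ with hP
  haveI : IsProbabilityMeasure P := isProbabilityMeasure_localGibbsLaw continuous_const continuous_const
    continuous_const (fun _ => ha) (fun _ => hθ) hσ2 N Φ
  set F : Cfg N → ℝ := frac K with hF
  have hFm : Measurable F := measurable_frac K
  have hF01 : ∀ w, F w ∈ Icc (0 : ℝ) 1 := fun w => frac_mem_Icc K w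
  set p : ℝ := ∫ w, F w ∂P with hp
  have hgood : P Φ.goodᶜ = 0 := by
    rw [hP, localGibbsLaw_eq]
    exact (localGibbsMeasure_absolutelyContinuous σ _ _ _ N Φ) Φ.measure_compl_good
  have hinv : ∀ s, MeasurePreserving (Φ.flow s) P P := fun s =>
    measurePreserving_flow_localGibbsLaw_const σ a θ₀ u₀ N Φ s
  set ν : Measure ℝ := volume.restrict (Icc 0 t) with hν
  have hνuniv : ν univ = ENNReal.ofReal t := by
    rw [hν, Measure.restrict_apply_univ, Real.volume_Icc, sub_zero]
  haveI : IsFiniteMeasure ν := ⟨by rw [hνuniv]; exact ENNReal.ofReal_lt_top⟩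
  have hνreal : ν.real univ = t := by rw [measureReal_def, hνuniv, ENNReal.toReal_ofReal ht]
  set occ : Cfg N → ℝ := fun z => (∫⁻ s, ENNReal.ofReal (F (Φ.flow s z)) ∂ν).toReal with hocc
  -- (1) the static variance in `lintegral` form
  have hstat : ∫⁻ w, ENNReal.ofReal ((F w - p) ^ 2) ∂P ≤ ENNReal.ofReal (1 / (4 * ((N + 1 : ℕ) : ℝ))) := by
    have hmem : MemLp F 2 P := memLp_of_bounded (Eventually.of_forall hF01) hFm.aestronglyMeasurable 2
    rw [hp, ← evariance_eq_lintegral_ofReal, ← ofReal_variance hmem]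
    exact ENNReal.ofReal_le_ofReal (variance_frac_le_const u₀ hσ2 ha hθ N Φ K)
  -- (2) Cauchy–Schwarz in time on every good orbit
  have hpt : ∀ z ∈ Φ.good, ENNReal.ofReal ((occ z - t * p) ^ 2) ≤
      ENNReal.ofReal t * ∫⁻ s, ENNReal.ofReal ((F (Φ.flow s z) - p) ^ 2) ∂ν := by
    intro z hz
    have horb : Measurable fun s => Φ.flow s z := (Φ.isTrajectory z hz).measurable_torus
    have hfm : Measurable fun s => F (Φ.flow s z) := hFm.comp horb
    have hfi : Integrable (fun s => F (Φ.flow s z)) ν :=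
      (memLp_of_bounded (Eventually.of_forall fun s => hF01 _) hfm.aestronglyMeasurable 1).integrable le_rfl
    have hgi : Integrable (fun s => F (Φ.flow s z) - p) ν := hfi.sub (integrable_const p)
    have hg01 : ∀ s, F (Φ.flow s z) - p ∈ Icc (-(1 + |p|)) (1 + |p|) := fun s => by
      have h1 := hF01 (Φ.flow s z)
      constructor <;> nlinarith [h1.1, h1.2, neg_abs_le p, le_abs_self p]
    have hg2i : Integrable (fun s => (F (Φ.flow s z) - p) ^ 2) ν :=
      (memLp_of_bounded (Eventually.of_forall hg01) (hfm.sub_const p).aestronglyMeasurable 2).integrable_sq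
    have hocc_eq : occ z = ∫ s, F (Φ.flow s z) ∂ν :=
      (integral_eq_lintegral_of_nonneg_ae (Eventually.of_forall fun s => (hF01 _).1) hfm.aestronglyMeasurable).symm
    have hsub : occ z - t * p = ∫ s, (F (Φ.flow s z) - p) ∂ν := by
      rw [integral_sub hfi (integrable_const p), integral_const, smul_eq_mul, hνreal, hocc_eq]
    have hcs := sq_integral_le_measureReal_mul_integral_sq hgi hg2i
    rw [hνreal, ← hsub] at hcs
    calc ENNReal.ofReal ((occ z - t * p) ^ 2)
        ≤ ENNReal.ofReal (t * ∫ s, (F (Φ.flow s z) - p) ^ 2 ∂ν) := ENNReal.ofReal_le_ofReal hcs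
      _ = ENNReal.ofReal t * ∫⁻ s, ENNReal.ofReal ((F (Φ.flow s z) - p) ^ 2) ∂ν := by
          rw [ENNReal.ofReal_mul ht,
            ofReal_integral_eq_lintegral_ofReal hg2i (Eventually.of_forall fun s => sq_nonneg _)]
  -- (3) Tonelli + invariance
  have hHm : Measurable fun w => ENNReal.ofReal ((F w - p) ^ 2) := ((hFm.sub_const p).pow_const 2).ennreal_ofReal
  obtain ⟨_, hTon⟩ := AdiabatCeiling.lintegral_lintegral_comp_flow_eq Φ hHm hgood hinv ν
  have hdyn : ∫⁻ z, ENNReal.ofReal ((occ z - t * p) ^ 2) ∂P ≤ ENNReal.ofReal (t ^ 2 / (4 * ((N + 1 : ℕ) : ℝ))) := by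
    calc ∫⁻ z, ENNReal.ofReal ((occ z - t * p) ^ 2) ∂P
        ≤ ∫⁻ z, ENNReal.ofReal t * ∫⁻ s, ENNReal.ofReal ((F (Φ.flow s z) - p) ^ 2) ∂ν ∂P := by
          refine lintegral_mono_ae ?_
          filter_upwards [(mem_ae_iff.2 hgood : ∀ᵐ z ∂P, z ∈ Φ.good)] with z hz using hpt z hz
      _ = ENNReal.ofReal t * ((∫⁻ w, ENNReal.ofReal ((F w - p) ^ 2) ∂P) * ν univ) := by
          rw [lintegral_const_mul' _ _ ENNReal.ofReal_ne_top, hTon]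
      _ ≤ ENNReal.ofReal t * (ENNReal.ofReal (1 / (4 * ((N + 1 : ℕ) : ℝ))) * ENNReal.ofReal t) := by
          rw [hνuniv]
          gcongr
      _ = ENNReal.ofReal (t ^ 2 / (4 * ((N + 1 : ℕ) : ℝ))) := by
          rw [← ENNReal.ofReal_mul (by positivity), ← ENNReal.ofReal_mul ht]
          congr 1
          ring
  -- (4) `Var occ ≤ E(occ - t p)²`
  have hoccm : AEStronglyMeasurable occ P :=
    ((AdiabatCeiling.aemeasurable_comp_flow_prod Φ hFm.ennreal_ofReal hgood ν).lintegral_prod_right').ennreal_toReal.aestronglyMeasurable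
  have hcm : AEStronglyMeasurable (fun z => occ z - t * p) P := hoccm.sub aestronglyMeasurable_const
  have hv1 : Var[occ; P] = Var[fun z => occ z - t * p; P] := (variance_sub_const hoccm (t * p)).symm
  have hv2 : Var[fun z => occ z - t * p; P] ≤ ∫ z, (occ z - t * p) ^ 2 ∂P := by
    have h := variance_le_expectation_sq hcm
    simpa only [Pi.pow_apply] using h
  have hv3 : ∫ z, (occ z - t * p) ^ 2 ∂P = (∫⁻ z, ENNReal.ofReal ((occ z - t * p) ^ 2) ∂P).toReal :=
    integral_eq_lintegral_of_nonneg_ae (Eventually.of_forall fun z => sq_nonneg _)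
      ((hoccm.aemeasurable.sub_const _).pow_const 2).aestronglyMeasurable
  rw [hv1]
  refine hv2.trans ?_
  rw [hv3]
  exact ENNReal.toReal_le_of_le_ofReal (by positivity) hdyn

/-- **The stub's conclusion at constant profiles, for every flow family** (`σ ≤ 1/2`, `a, θ₀ > 0`, `t ≥ 0`):
`Var_{P_N}(occ_K) ≤ t²/(4(N+1)) → 0` for every level `K`. -/
theorem occupationVariance_tendsto_const {σ a θ₀ : ℝ} (u₀ : V3) (hσ2 : σ ≤ 1 / 2) (ha : 0 < a) (hθ : 0 < θ₀)
    (Φ : (N : ℕ) → HardSphereFlow (Torus.geometry (Fin 3)) (hsDiameter σ N) (N + 1)) {t : ℝ} (ht : 0 ≤ t)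
    (K : ℝ) :
    Tendsto (fun N : ℕ => variance
      (fun z => (∫⁻ s in Icc 0 t, ENNReal.ofReal (frac K ((Φ N).flow s z))).toReal)
      (localGibbsLaw σ (fun _ => a) (fun _ => u₀) (fun _ => θ₀) N (Φ N))) atTop (𝓝 0) := by
  refine squeeze_zero (fun N => variance_nonneg _ _)
    (fun N => variance_occ_le_const u₀ hσ2 ha hθ N (Φ N) ht K) ?_
  have h := (tendsto_const_div_atTop_nhds_zero_nat (t ^ 2 / 4)).comp (tendsto_add_atTop_nat 1)
  refine h.congr fun N => ?_
  simp only [Function.comp_apply]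
  rw [div_div]

/-- **`stub_occupationVariance` AT CONSTANT DATA** (the registered stub of the line `meso-chebyshev-window`,
verbatim, specialised to constant profiles `(a₀, θ₀, u₀) ≡ (a, θ₀, u₀)`): the whole crux prefix (classical
solution, `t = 0` law of large numbers, horizon `t < T`, dilute chamber) is then idle — `σ₀ := 1/2`, `η₁ := 1`,
and `occupationVariance_tendsto_const` applies to every flow family, every `t > 0` and every level `K`.  This is
the equilibrium unit test of the stub (the place where the landed negatives of the crux live: none bites). -/
theorem occupationVariance_homogeneous :
    ∀ (a θ₀ : ℝ) (u₀ : V3), 0 < a → 0 < θ₀ →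
      ∃ σ₀ : ℝ, 0 < σ₀ ∧ ∃ η₁ : ℝ, 0 < η₁ ∧ ∀ σ : ℝ, 0 < σ → σ < σ₀ →
        ∀ (T : ℝ) (ρ θ : ℝ → T3 → ℝ) (u : ℝ → T3 → V3), IsHardSphereEulerSolution σ T ρ u θ →
        ∀ Φ : (N : ℕ) → HardSphereFlow (Torus.geometry (Fin 3)) (hsDiameter σ N) (N + 1),
          TendstoHydroFieldsAt
              (fun N => localGibbsLaw σ (fun _ => a) (fun _ => u₀) (fun _ => θ₀) N (Φ N)) Φ ρ u θ 0 →
          ∀ t : ℝ, 0 < t → t < T → (∀ s ∈ Icc 0 t, ∀ x, 2 * ρ s x * σ ^ 3 < η₁) →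
            ∀ K : ℝ, Tendsto (fun N : ℕ => variance
              (fun z => (∫⁻ s in Icc 0 t, ENNReal.ofReal (frac K ((Φ N).flow s z))).toReal)
              (localGibbsLaw σ (fun _ => a) (fun _ => u₀) (fun _ => θ₀) N (Φ N))) atTop (𝓝 0) :=
  fun _a _θ₀ u₀ ha hθ => ⟨1 / 2, one_half_pos, 1, one_pos, fun _σ _ hσ _T _ρ _θ _u _ Φ _ _t ht _ _ K =>
    occupationVariance_tendsto_const u₀ hσ.le ha hθ Φ ht.le K⟩

end Summit.AtomisticToContinuum.HydrodynamicLimit.Theorems.MesoChebyshevWindow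

end
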